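import Summits.AtomisticToContinuum.Crystallization.Theorems.ReggeStarCoercivityDefectFreeCrystallizesLayeredGluing02

/-!
# Part 3 of the proof of `stub_layeredGluing : LayeredGluing` (S5a, line `prestress-split-korn`, crux stmt-AtomisticToContinuum-13603); see the module docstring of the final part `ReggeStarCoercivityDefectFreeCrystallizesLayeredGluing.lean` for the overview
-/

noncomputable section

open scoped BigOperators Classical InnerProductSpace
open Filter Topology

namespace Summit.AtomisticToContinuum.Crystallization.Theorems.PrestressSplitKorn

open Summit.AtomisticToContinuum.Crystallization.Theses
open Summit.AtomisticToContinuum.Crystallization.Theses.ReggeStarCoercivity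
open Summit.AtomisticToContinuum.Crystallization.Theorems.DefectFreeCrystallizes.Negative.PredicateAPI
open Literature.MathematicalPhysics.StatisticalMechanics Literature.Geometry.DiscreteGeometry


section Framed

variable {a : ℝ} {s : ℤ → ℤ} {z : ℤ → ℝ}

/-- Auxiliary step `InBox.norm_v_lt` of the proof of `stub_layeredGluing` (S5a); see the final part's module docstring. -/
theorem InBox.norm_v_lt (h : InBox a z) : ‖triangularVec₂ a‖ < 2 := by
  apply norm_lt_two_of_sq
  have := norm_sq_planar a 0 1
  simp only [one_smul, zero_smul, zero_add] at this
  rw [this]; nlinarith [h.1, h.2.1]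

/-- Auxiliary step `InBox.z_one` of the proof of `stub_layeredGluing` (S5a); see the final part's module docstring. -/
theorem InBox.z_one (h : InBox a z) (hz0 : z 0 = 0) : 39 / 50 * a ≤ z 1 ∧ z 1 ≤ 17 / 20 * a := by
  have := h.2.2 0; rw [zero_add, hz0, sub_zero] at this; exact this

/-- Auxiliary step `InBox.z_neg_one` of the proof of `stub_layeredGluing` (S5a); see the final part's module docstring. -/
theorem InBox.z_neg_one (h : InBox a z) (hz0 : z 0 = 0) :
    39 / 50 * a ≤ -z (-1) ∧ -z (-1) ≤ 17 / 20 * a := by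
  have := h.2.2 (-1); rw [neg_add_cancel, hz0, zero_sub] at this; exact this

/-- Auxiliary step `InBox.norm_up_lt` of the proof of `stub_layeredGluing` (S5a); see the final part's module docstring. -/
theorem InBox.norm_up_lt (h : InBox a z) (hz0 : z 0 = 0) (hs : IsHaggSeq s) :
    ‖(s 0 : ℝ) • barlowOffset a + z 1 • layerNormal 1‖ < 2 := by
  apply norm_lt_two_of_sq
  rw [norm_sq_offset a _ _ (by rcases hs 0 with h' | h' <;> simp [h'])]
  have := h.z_one hz0
  nlinarith [h.1, h.2.1, this.1, this.2]

/-- Auxiliary step `InBox.norm_down_lt` of the proof of `stub_layeredGluing` (S5a); see the final part's module docstring. -/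
theorem InBox.norm_down_lt (h : InBox a z) (hz0 : z 0 = 0) (hs : IsHaggSeq s) :
    ‖(-(s (-1)) : ℝ) • barlowOffset a + z (-1) • layerNormal 1‖ < 2 := by
  apply norm_lt_two_of_sq
  rw [show ((-(s (-1)) : ℝ)) = ((-(s (-1)) : ℤ) : ℝ) by push_cast; ring,
    norm_sq_offset a _ _ (by rcases hs (-1) with h' | h' <;> simp [h'])]
  have := h.z_neg_one hz0
  nlinarith [h.1, h.2.1, this.1, this.2]

/-- Auxiliary step `InBox.strictMono` of the proof of `stub_layeredGluing` (S5a); see the final part's module docstring. -/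
theorem InBox.strictMono (h : InBox a z) : StrictMono z := by
  apply strictMono_int_of_lt_succ
  intro m
  have := (h.2.2 m).1
  nlinarith [h.1]

/-- No height strictly between `z 0 = 0` and `z 1`, nor between `z (-1)` and `0`. -/
theorem InBox.not_between (h : InBox a z) (hz0 : z 0 = 0) (m : ℤ) :
    ¬ (0 < z m ∧ z m < z 1) ∧ ¬ (z (-1) < z m ∧ z m < 0) := by
  have hsm := h.strictMono
  constructor
  · rintro ⟨h1, h2⟩
    rw [← hz0] at h1
    have a1 : 0 < m := hsm.lt_iff_lt.1 h1
    have a2 : m < 1 := hsm.lt_iff_lt.1 h2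
    omega
  · rintro ⟨h1, h2⟩
    rw [← hz0] at h2
    have a1 : -1 < m := hsm.lt_iff_lt.1 h1
    have a2 : m < 0 := hsm.lt_iff_lt.1 h2
    omega

/-- Auxiliary step `InBox.z_eq_zero_iff` of the proof of `stub_layeredGluing` (S5a); see the final part's module docstring. -/
theorem InBox.z_eq_zero_iff (h : InBox a z) (hz0 : z 0 = 0) (m : ℤ) : z m = 0 ↔ m = 0 := by
  constructor
  · intro hm; rw [← hz0] at hm; exact h.strictMono.injective hm
  · rintro rfl; exact hz0

/-- `(σ - σ') w ∈ ℤu + ℤv` forces `σ = σ'` for signs `σ, σ'`. -/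
theorem sign_eq_of_offset_mem (ha : a ≠ 0) {σ σ' : ℤ} (hσ : σ = 1 ∨ σ = -1) (hσ' : σ' = 1 ∨ σ' = -1)
    {i j : ℤ} (h : ((σ : ℝ) - σ') • barlowOffset a = (i : ℝ) • triangularVec₁ a + (j : ℝ) • triangularVec₂ a) :
    σ = σ' := by
  have h1 := congrArg (fun x : EuclideanSpace ℝ (Fin 3) => x 1) h
  simp [barlowOffset, triangularVec₁, triangularVec₂] at h1
  have h3 : (√3 : ℝ) ≠ 0 := by positivity
  have : ((σ : ℝ) - σ') = 3 * j := by
    field_simp at h1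
    linarith
  have hint : σ - σ' = 3 * j := by exact_mod_cast this
  rcases hσ with rfl | rfl <;> rcases hσ' with rfl | rfl <;> omega

/-- Planar covering: every horizontal vector is within `2a/3` of `ℤu + ℤv`. -/
theorem exists_planar_near (ha : 0 < a) (d : EuclideanSpace ℝ (Fin 3)) (hd : d 2 = 0) :
    ∃ i j : ℤ, ‖d - ((i : ℝ) • triangularVec₁ a + (j : ℝ) • triangularVec₂ a)‖ ^ 2 ≤ 4 * a ^ 2 / 9 := by
  have hs3 : (√3 : ℝ) ^ 2 = 3 := Real.sq_sqrt (by norm_num)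
  have hs3pos : 0 < (√3 : ℝ) := by positivity
  set g : ℝ := d 1 / (a * √3 / 2) with hg
  set f : ℝ := d 0 / a - g / 2 with hf
  have hd0 : d 0 = a * (f + g / 2) := by rw [hf]; field_simp; ring
  have hd1 : d 1 = a * √3 / 2 * g := by rw [hg]; field_simp
  obtain ⟨i', j', hab⟩ := exists_corner_form_le (Int.fract_nonneg f) (Int.fract_lt_one f).le
    (Int.fract_nonneg g) (Int.fract_lt_one g).le
  refine ⟨⌊f⌋ + i', ⌊g⌋ + j', ?_⟩
  have hfi : f - ⌊f⌋ = Int.fract f := rfl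
  have hgj : g - ⌊g⌋ = Int.fract g := rfl
  rw [norm_sq_fin3]
  simp only [PiLp.sub_apply, PiLp.add_apply, PiLp.smul_apply, smul_eq_mul, hd0, hd1, hd]
  simp [triangularVec₁, triangularVec₂]
  have e0 : a * (f + g / 2) - (((⌊f⌋ : ℝ) + i') * a + ((⌊g⌋ : ℝ) + j') * (a / 2)) =
      a * ((Int.fract f - i') + (Int.fract g - j') / 2) := by rw [← hfi, ← hgj]; ring
  have e1 : a * √3 / 2 * g - ((⌊g⌋ : ℝ) + j') * (a * √3 / 2) =
      a * √3 / 2 * (Int.fract g - j') := by rw [← hgj]; ring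
  rw [e0, e1]
  have : (a * ((Int.fract f - i') + (Int.fract g - j') / 2)) ^ 2 + (a * √3 / 2 * (Int.fract g - j')) ^ 2
      = a ^ 2 * ((Int.fract f - i') ^ 2 + (Int.fract f - i') * (Int.fract g - j') + (Int.fract g - j') ^ 2) := by
    linear_combination (a ^ 2 * (Int.fract g - j') ^ 2 / 4) * hs3
  rw [this]
  nlinarith [hab, sq_nonneg a]

/-- Auxiliary step `InBox.eq_one_of_z_mem` of the proof of `stub_layeredGluing` (S5a); see the final part's module docstring. -/
theorem InBox.eq_one_of_z_mem (h : InBox a z) (hz0 : z 0 = 0) {m : ℤ}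
    (hm : 39 / 50 * a ≤ z m ∧ z m ≤ 17 / 20 * a) : m = 1 := by
  have hsm := h.strictMono
  have ha := h.a_pos
  have h1 : 0 < m := by
    have : z 0 < z m := by rw [hz0]; linarith [hm.1]
    exact hsm.lt_iff_lt.1 this
  have h2 : m < 2 := by
    by_contra hc
    push Not at hc
    have hz2 := (h.le_z_natCast 2).1
    rw [hz0, sub_zero] at hz2
    have : z 2 ≤ z m := hsm.monotone (by exact_mod_cast hc)
    push_cast at hz2
    linarith [hm.2]
  omega

/-- Auxiliary step `InBox.eq_neg_one_of_z_mem` of the proof of `stub_layeredGluing` (S5a); see the final part's module docstring. -/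
theorem InBox.eq_neg_one_of_z_mem (h : InBox a z) (hz0 : z 0 = 0) {m : ℤ}
    (hm : 39 / 50 * a ≤ -z m ∧ -z m ≤ 17 / 20 * a) : m = -1 := by
  have hsm := h.strictMono
  have ha := h.a_pos
  have h1 : m < 0 := by
    have : z m < z 0 := by rw [hz0]; linarith [hm.1]
    exact hsm.lt_iff_lt.1 this
  have h2 : -2 < m := by
    by_contra hc
    push Not at hc
    have hz2 := (h.le_z_neg_natCast 2).1
    rw [hz0, zero_sub] at hz2
    have : z m ≤ z (-2) := hsm.monotone (by exact_mod_cast hc)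
    push_cast at hz2
    linarith [hm.2]
  omega

variable {Y : Set (EuclideanSpace ℝ (Fin 3))}

/-! ### Step 1: layers are full triangular lattices -/

/-- Auxiliary step `layeredPos_origin` of the proof of `stub_layeredGluing` (S5a); see the final part's module docstring. -/
theorem layeredPos_origin (hz0 : z 0 = 0) : layeredPos a s z (0, 0, 0) = 0 := by
  simp [layeredPos, hz0]

/-- Auxiliary step `FramedAt.mem` of the proof of `stub_layeredGluing` (S5a); see the final part's module docstring. -/
theorem FramedAt.mem {p : EuclideanSpace ℝ (Fin 3)} (h : FramedAt a Y p s z) : p ∈ Y := by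
  have := h.2.2.2.2 (0, 0, 0) (by rw [layeredPos_origin h.2.2.1]; simp)
  rwa [layeredPos_origin h.2.2.1, add_zero] at this

/-- Auxiliary step `FramedAt.hex_mem` of the proof of `stub_layeredGluing` (S5a); see the final part's module docstring. -/
theorem FramedAt.hex_mem {p : EuclideanSpace ℝ (Fin 3)} (h : FramedAt a Y p s z) :
    p + triangularVec₁ a ∈ Y ∧ p - triangularVec₁ a ∈ Y ∧
      p + triangularVec₂ a ∈ Y ∧ p - triangularVec₂ a ∈ Y := by
  obtain ⟨hbox, hs, hz0, -, h2⟩ := h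
  have e1 : layeredPos a s z (0, 1, 0) = triangularVec₁ a := by rw [layeredPos_layer_zero hz0]; simp
  have e2 : layeredPos a s z (0, -1, 0) = -triangularVec₁ a := by rw [layeredPos_layer_zero hz0]; simp
  have e3 : layeredPos a s z (0, 0, 1) = triangularVec₂ a := by rw [layeredPos_layer_zero hz0]; simp
  have e4 : layeredPos a s z (0, 0, -1) = -triangularVec₂ a := by rw [layeredPos_layer_zero hz0]; simp
  refine ⟨?_, ?_, ?_, ?_⟩
  · have := h2 (0, 1, 0) (by rw [e1]; exact hbox.norm_u_lt); rwa [e1] at this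
  · have := h2 (0, -1, 0) (by rw [e2, norm_neg]; exact hbox.norm_u_lt)
    rwa [e2, ← sub_eq_add_neg] at this
  · have := h2 (0, 0, 1) (by rw [e3]; exact hbox.norm_v_lt); rwa [e3] at this
  · have := h2 (0, 0, -1) (by rw [e4, norm_neg]; exact hbox.norm_v_lt)
    rwa [e4, ← sub_eq_add_neg] at this

/-- **Step 1.** The layer of a point is the full triangular lattice through it. -/
theorem layer_full (hY : AllFramed a Y) {p : EuclideanSpace ℝ (Fin 3)} (hp : p ∈ Y) (i j : ℤ) :
    p + ((i : ℝ) • triangularVec₁ a + (j : ℝ) • triangularVec₂ a) ∈ Y := by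
  have hi : ∀ i : ℤ, p + (i : ℝ) • triangularVec₁ a ∈ Y := by
    intro i
    induction i using Int.induction_on with
    | zero => simpa using hp
    | succ n ih =>
      obtain ⟨s, z, h⟩ := hY _ ih
      convert h.hex_mem.1 using 1
      push_cast; module
    | pred n ih =>
      obtain ⟨s, z, h⟩ := hY _ ih
      convert h.hex_mem.2.1 using 1
      push_cast; module
  induction j using Int.induction_on with
  | zero => simpa using hi i
  | succ n ih =>
    obtain ⟨s, z, h⟩ := hY _ ih
    convert h.hex_mem.2.2.1 using 1
    push_cast; module
  | pred n ih =>
    obtain ⟨s, z, h⟩ := hY _ ih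
    convert h.hex_mem.2.2.2 using 1
    push_cast; module

/-- Auxiliary step `AllFramed.layerFramed` of the proof of `stub_layeredGluing` (S5a); see the final part's module docstring. -/
theorem AllFramed.layerFramed (hY : AllFramed a Y) {p : EuclideanSpace ℝ (Fin 3)} (hp : p ∈ Y) : LayerFramed a Y p :=
  fun i j => hY _ (layer_full hY hp i j)

/-- Auxiliary step `LayerFramed.base` of the proof of `stub_layeredGluing` (S5a); see the final part's module docstring. -/
theorem LayerFramed.base {p : EuclideanSpace ℝ (Fin 3)} (hL : LayerFramed a Y p) : ∃ (s : ℤ → ℤ) (z : ℤ → ℝ), FramedAt a Y p s z := by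
  obtain ⟨s, z, h⟩ := hL 0 0
  exact ⟨s, z, by simpa using h⟩

/-! ### Step 2: a layer contains nothing but its lattice -/

/-- **Step 2.** A point of `Y` at the height of `p ∈ Y` is a lattice point of the layer of `p`. -/
theorem layer_exact {p y : EuclideanSpace ℝ (Fin 3)} (hL : LayerFramed a Y p) (hy : y ∈ Y) (hh : y 2 = p 2) :
    ∃ i j : ℤ, y = p + ((i : ℝ) • triangularVec₁ a + (j : ℝ) • triangularVec₂ a) := by
  obtain ⟨s₀, z₀, h₀⟩ := hL.base
  have ha : 0 < a := h₀.1.a_pos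
  have ha1 : a ≤ 1 := h₀.1.2.1
  have hyp2 : (y - p) 2 = 0 := by rw [PiLp.sub_apply, hh, sub_self]
  obtain ⟨i, j, hij⟩ := exists_planar_near ha (y - p) hyp2
  set q : EuclideanSpace ℝ (Fin 3) := p + ((i : ℝ) • triangularVec₁ a + (j : ℝ) • triangularVec₂ a) with hq
  obtain ⟨s, z, hbox, hs, hz0, h1, -⟩ := hL i j
  rw [← hq] at h1
  have hd : dist y q < 2 := by
    have e : y - q = y - p - ((i : ℝ) • triangularVec₁ a + (j : ℝ) • triangularVec₂ a) := by
      rw [hq]; abel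
    rw [dist_eq_norm, e]
    apply norm_lt_two_of_sq
    have : 4 * a ^ 2 / 9 < 4 := by nlinarith
    linarith
  obtain ⟨l, hl⟩ := h1 y hy hd
  have h2c : z l.1 = 0 := by
    have := congrArg (fun x : EuclideanSpace ℝ (Fin 3) => x 2) hl
    simp only [hq, PiLp.add_apply, PiLp.smul_apply, smul_eq_mul, layeredPos_apply_two] at this
    have hu : (triangularVec₁ a) 2 = 0 := by simp [triangularVec₁]
    have hv : (triangularVec₂ a) 2 = 0 := by simp [triangularVec₂]
    rw [hu, hv] at this
    linarith
  have hm : l.1 = 0 := (hbox.z_eq_zero_iff hz0 _).1 h2c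
  refine ⟨i + l.2.1, j + l.2.2, ?_⟩
  rw [hl, hq]
  obtain ⟨m, i', j'⟩ := l
  simp only at hm
  subst hm
  rw [layeredPos_layer_zero hz0]
  push_cast
  module

/-! ### Step 3: adjacent lattice points read the same adjacent layers -/

/-- Squared distance from the neighbour `e = u` or `v` to the first site of layer `±1`. -/
theorem norm_sq_offset_sub (a σ h : ℝ) (hσ : σ = 1 ∨ σ = -1) {e : EuclideanSpace ℝ (Fin 3)}
    (he : e = 0 ∨ e = triangularVec₁ a ∨ e = triangularVec₂ a) :
    ‖σ • barlowOffset a + h • layerNormal 1 - e‖ ^ 2 ≤ 7 / 3 * a ^ 2 + h ^ 2 := by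
  have h3 : (√3 : ℝ) ^ 2 = 3 := Real.sq_sqrt (by norm_num)
  rw [norm_sq_fin3]
  rcases he with rfl | rfl | rfl <;> rcases hσ with rfl | rfl <;>
    simp [barlowOffset, layerNormal, triangularVec₁, triangularVec₂] <;> nlinarith [h3, sq_nonneg a]

/-- **Step 3.** If `p` and its neighbour `p + e` (`e = u` or `v`) both carry identity-framed templates,
the two templates have the same first layers above and below (same heights, same letters). -/
theorem framed_data_eq {p e : EuclideanSpace ℝ (Fin 3)} (he : e = 0 ∨ e = triangularVec₁ a ∨ e = triangularVec₂ a)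
    {s' : ℤ → ℤ} {z' : ℤ → ℝ} (hp : FramedAt a Y p s z) (hq : FramedAt a Y (p + e) s' z') :
    z' 1 = z 1 ∧ s' 0 = s 0 ∧ z' (-1) = z (-1) ∧ s' (-1) = s (-1) := by
  obtain ⟨hbox, hs, hz0, -, hp2⟩ := hp
  obtain ⟨hbox', hs', hz0', hq1, -⟩ := hq
  have ha := hbox.a_pos
  have ha1 := hbox.2.1
  have he2 : e 2 = 0 := by rcases he with rfl | rfl | rfl <;> simp [triangularVec₁, triangularVec₂]
  have heΛ : ∃ i₀ j₀ : ℤ, e = (i₀ : ℝ) • triangularVec₁ a + (j₀ : ℝ) • triangularVec₂ a := by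
    rcases he with rfl | rfl | rfl
    · exact ⟨0, 0, by simp⟩
    · exact ⟨1, 0, by simp⟩
    · exact ⟨0, 1, by simp⟩
  -- the layer above
  have hup : z' 1 = z 1 ∧ s' 0 = s 0 := by
    set t : EuclideanSpace ℝ (Fin 3) := p + ((s 0 : ℝ) • barlowOffset a + z 1 • layerNormal 1) with ht
    have htY : t ∈ Y := by
      have := hp2 (1, 0, 0) (by rw [layeredPos_one]; exact hbox.norm_up_lt hz0 hs)
      rwa [layeredPos_one] at this
    have hσ : (s 0 : ℝ) = 1 ∨ (s 0 : ℝ) = -1 := by rcases hs 0 with h | h <;> simp [h]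
    have hdist : dist t (p + e) < 2 := by
      have ee : t - (p + e) = (s 0 : ℝ) • barlowOffset a + z 1 • layerNormal 1 - e := by
        rw [ht]; abel
      rw [dist_eq_norm, ee]
      apply norm_lt_two_of_sq
      have := norm_sq_offset_sub a (s 0 : ℝ) (z 1) hσ he
      have hz1 := hbox.z_one hz0
      nlinarith [hz1.1, hz1.2]
    obtain ⟨l, hl⟩ := hq1 t htY hdist
    -- heights
    have hzl : z' l.1 = z 1 := by
      have := congrArg (fun x : EuclideanSpace ℝ (Fin 3) => x 2) hl
      simp only [ht, PiLp.add_apply, PiLp.smul_apply, smul_eq_mul, layeredPos_apply_two, he2] at this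
      have hw2 : (barlowOffset a) 2 = 0 := by simp [barlowOffset]
      have hn2 : (layerNormal 1 : EuclideanSpace ℝ (Fin 3)) 2 = 1 := by simp [layerNormal]
      rw [hw2, hn2] at this
      linarith
    have hl1 : l.1 = 1 := hbox'.eq_one_of_z_mem hz0' (by rw [hzl]; exact hbox.z_one hz0)
    refine ⟨by rw [← hzl, hl1], ?_⟩
    -- letters
    obtain ⟨m, i', j'⟩ := l
    simp only at hl1
    subst hl1
    obtain ⟨i₀, j₀, he0⟩ := heΛ
    have key : ((s 0 : ℝ) - (s' 0 : ℝ)) • barlowOffset a =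
        ((i' + i₀ : ℤ) : ℝ) • triangularVec₁ a + ((j' + j₀ : ℤ) : ℝ) • triangularVec₂ a := by
      have hl' := hl
      rw [ht, he0] at hl'
      simp only [layeredPos] at hl'
      have h1' : haggLabel s' 1 = s' 0 := by
        have := haggLabel_succ s' 0; simp only [zero_add, haggLabel_zero] at this; exact this
      rw [h1'] at hl'
      simp only at hzl
      rw [hzl] at hl'
      push_cast
      -- hl' : p + (σ w + h e) = p + (i₀ u + j₀ v) + (i' u + j' v + σ' w + h e)
      have : (s 0 : ℝ) • barlowOffset a - (s' 0 : ℝ) • barlowOffset a =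
          ((i' : ℝ) + i₀) • triangularVec₁ a + ((j' : ℝ) + j₀) • triangularVec₂ a := by
        linear_combination (norm := module) hl'
      rw [← this, sub_smul]
    have := sign_eq_of_offset_mem ha.ne' (hs 0) (hs' 0) key
    exact this.symm
  -- the layer below
  have hdn : z' (-1) = z (-1) ∧ s' (-1) = s (-1) := by
    set t : EuclideanSpace ℝ (Fin 3) := p + ((-(s (-1)) : ℝ) • barlowOffset a + z (-1) • layerNormal 1) with ht
    have htY : t ∈ Y := by
      have := hp2 (-1, 0, 0) (by rw [layeredPos_neg_one]; exact hbox.norm_down_lt hz0 hs)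
      rwa [layeredPos_neg_one] at this
    have hσ : (-(s (-1)) : ℝ) = 1 ∨ (-(s (-1)) : ℝ) = -1 := by
      rcases hs (-1) with h | h <;> simp [h]
    have hdist : dist t (p + e) < 2 := by
      have ee : t - (p + e) = (-(s (-1)) : ℝ) • barlowOffset a + z (-1) • layerNormal 1 - e := by
        rw [ht]; abel
      rw [dist_eq_norm, ee]
      apply norm_lt_two_of_sq
      have := norm_sq_offset_sub a (-(s (-1)) : ℝ) (z (-1)) hσ he
      have hz1 := hbox.z_neg_one hz0
      nlinarith [hz1.1, hz1.2]
    obtain ⟨l, hl⟩ := hq1 t htY hdist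
    have hzl : z' l.1 = z (-1) := by
      have := congrArg (fun x : EuclideanSpace ℝ (Fin 3) => x 2) hl
      simp only [ht, PiLp.add_apply, PiLp.smul_apply, smul_eq_mul, layeredPos_apply_two, he2] at this
      have hw2 : (barlowOffset a) 2 = 0 := by simp [barlowOffset]
      have hn2 : (layerNormal 1 : EuclideanSpace ℝ (Fin 3)) 2 = 1 := by simp [layerNormal]
      rw [hw2, hn2] at this
      linarith
    have hl1 : l.1 = -1 := hbox'.eq_neg_one_of_z_mem hz0' (by rw [hzl]; exact hbox.z_neg_one hz0)
    refine ⟨by rw [← hzl, hl1], ?_⟩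
    obtain ⟨m, i', j'⟩ := l
    simp only at hl1
    subst hl1
    obtain ⟨i₀, j₀, he0⟩ := heΛ
    have key : ((s' (-1) : ℝ) - (s (-1) : ℝ)) • barlowOffset a =
        ((i' + i₀ : ℤ) : ℝ) • triangularVec₁ a + ((j' + j₀ : ℤ) : ℝ) • triangularVec₂ a := by
      have hl' := hl
      rw [ht, he0] at hl'
      simp only [layeredPos, haggLabel_neg_one] at hl'
      simp only at hzl
      rw [hzl] at hl'
      push_cast at hl' ⊢
      have : (s' (-1) : ℝ) • barlowOffset a - (s (-1) : ℝ) • barlowOffset a =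
          ((i' : ℝ) + i₀) • triangularVec₁ a + ((j' : ℝ) + j₀) • triangularVec₂ a := by
        linear_combination (norm := module) hl'
      rw [← this, sub_smul]
    exact sign_eq_of_offset_mem ha.ne' (hs' (-1)) (hs (-1)) key
  exact ⟨hup.1, hup.2, hdn.1, hdn.2⟩

/-! ### Step 4: the adjacent layers are full, at constant height, with nothing in between -/

/-- Landing anchor of this file (registered stub of crux stmt-AtomisticToContinuum-13603; re-exports a result above). -/
theorem layeredGluing_part03_anchor :
    ∀ (a : ℝ) (z : ℤ → ℝ), InBox a z → StrictMono z :=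
  fun _ _ h => h.strictMono

end Framed

end Summit.AtomisticToContinuum.Crystallization.Theorems.PrestressSplitKorn
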